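import Summits.FinalStateConjecture.FinalStateConjecture.Theorems.SwallowTheDatumUniversalWitnessFamilySheetLineReduction
import HarnessLib

/-!
# Route SwallowTheDatum — glue of the sheet-line decomposition of the target
# (item stmt-FinalStateConjecture-15429 · `SheetLineGlue`)

The support item `SheetLineGlue` of route `SwallowTheDatum` (rev 9) is the implication
`FarAnnulusGluing → UniversalSocketBag → SheetShieldedSettles → UniversalWitnessFamily`:
far-annulus gluing (the d-side parametric atom, item stmt-FinalStateConjecture-15427) → the DEEP universal socket
bag (the d-free analytic atom, item 15426) → sheet-shielded admissible data satisfy the summit conclusion `P`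
(S-side, item 15428) → the route's target `UniversalWitnessFamily` (item 10051).  It is the typed glue of the
crux-strategist's split of the target (`Cruxes/UniversalWitnessFamily/STRATEGY-CENSUS.md` §Decomposition; the
strategist's certificate `Split.lean::universalWitnessFamily_of_subs`, evidence on item 10051 @ 2026-08-16T15:07Z,
is re-derived here from the tree alone).

Proof (pure logic over LANDED theorems).  The three route statements are, by `δ`-unfolding of the line vocabulary
`SmoothSectionsOn` / `AgreeAt` / `IsExactSchwarzschildBeyond` / `IsSchwarzschildAnnulus`
(`…ParametricKerrBurialLine.lean`) and `VacuumOn` / `IsIsotropicBeyond` (`…ParametricKerrBurialCollarLine.lean`),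
literally the hypotheses of the landed sheet-line plumbing: `socketBag_of_socketBagDeep`
(`…UniversalWitnessFamilySheetLineReduction.lean`) turns the deep bag into the open-sheet bag; `sheetBurial_of`
(`…UniversalWitnessFamilySheetLine.lean`), fed with the three LANDED geometric stubs `stub_socketDilation`,
`stub_socketTransportPatch`, `stub_sheetBreathing` (and, inside, the landed `junction` lemma), produces through
every admissible datum `d` a smooth injective admissible family `F` with `F 0 = d` whose members off `c = 0` are
sheet-shielded; and `SheetShieldedSettles` applied to the admissible sheet-shielded member `F c` is exactly the
summit conclusion `P (F c)` (`∃` maximal development `∧` the `∀`-MGHD clauses).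

Statement shape.  As for the route's other glue items (`…WitnessFamilyOfCruxesFrame.lean`,
`…AssemblyFrame.lean`) the theorem is stated in FRAME FORM: the four route statements `FarAnnulusGluing`,
`UniversalSocketBag`, `SheetShieldedSettles`, `UniversalWitnessFamily` are INLINED VERBATIM (bodies copied from the
route file rev 9), so that the type is the route decl
`Summit.FinalStateConjecture.FinalStateConjecture.Theses.SwallowTheDatum.SheetLineGlue` by `δ`-reduction alone and
elaborates independently of the route module's revision.  Unlike those two files this one cannot avoid importing
the route module (the landed plumbing it rests on — `…SheetLine.lean` via `…ThroatSettlesToo.lean`, and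
`…ParametricKerrBurialLine.lean` — imports it), so the gate records the closure as a docstring link rather than a
`_holds` theorem (docs/reference/gate.md §4.2); the closing theorem `SwallowTheDatum.sheetLineGlue_proof` is the
same proof stated BY NAME against the route decl.  No analysis, no new definitions; the theorems credit exactly
their three displayed hypotheses.
-/

-- `Summit.<Summit>.<Problem>` is the tree's mandated summit-side namespace (CONVENTIONS §2); for this
-- single-conjunct summit the two coincide, so the duplicate is deliberate.
set_option linter.dupNamespace false

namespace Summit.FinalStateConjecture.FinalStateConjecture.Theorems

open scoped BigOperators Topology Manifold Classical MeasureTheory ProbabilityTheory Matrix InnerProductSpace ComplexConjugate ContinuousMap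
open Filter Set Function TopologicalSpace MeasureTheory

open Summit.FinalStateConjecture.FinalStateConjecture.Theorems.SwallowTheDatum.UniversalWitnessFamily
  (stub_socketDilation stub_socketTransportPatch stub_sheetBreathing)
open Summit.FinalStateConjecture.FinalStateConjecture.Theorems.SwallowTheDatum.UniversalWitnessFamily.SheetLine
  (sheetBurial_of socketBag_of_socketBagDeep)

/-- **Glue of the sheet-line decomposition of route SwallowTheDatum, frame form**
(item stmt-FinalStateConjecture-15429): `FarAnnulusGluing → UniversalSocketBag → SheetShieldedSettles →
UniversalWitnessFamily`, with the four route statements written out verbatim so that this type unfolds to the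
route decl `Summit.FinalStateConjecture.FinalStateConjecture.Theses.SwallowTheDatum.SheetLineGlue` by `δ`-reduction
alone.  Proof: the witness family through the admissible datum `d` is the SHEET BURIAL family `F` of the landed
`sheetBurial_of` (far-annulus gluing + the open-sheet socket bag obtained from the deep one by the landed
`socketBag_of_socketBagDeep` + the landed geometric stubs `stub_socketDilation`, `stub_socketTransportPatch`,
`stub_sheetBreathing`); every `F c` is admissible and, for `c ≠ 0`, sheet-shielded, so the third hypothesis at
`F c` is the summit conclusion.  The route statements match the hypotheses of the landed lemmas by `δ`-unfolding of
the line vocabulary (`SmoothSectionsOn`, `AgreeAt`, `IsExactSchwarzschildBeyond`, `VacuumOn`,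
`IsSchwarzschildAnnulus`, `IsIsotropicBeyond`) only. [folklore] -/
theorem SwallowTheDatum.sheetLineGlue_frame_proof :
    (∀ (X : Type) [TopologicalSpace X] [ChartedSpace Literature.Geometry.Lorentzian.E3 X] [IsManifold (𝓡 3) ((⊤ : ℕ∞) : WithTop ℕ∞) X] [T2Space X] [SecondCountableTopology X] [ConnectedSpace X], ∀ d ∈ Literature.Geometry.Lorentzian.admissibleVacuumData X, ∃ (η : ℝ) (e : Literature.Geometry.Lorentzian.AFEnd X) (Rstar : ℝ) (m : ℝ → ℝ) (G : ℝ → Literature.Geometry.Lorentzian.InitialDataSet (𝓡 3) X), 0 < η ∧ e.IsSoleEnd ∧ e.R < Rstar ∧ ContDiff ℝ ((⊤ : ℕ∞) : WithTop ℕ∞) m ∧ (ContMDiffOn (𝓘(ℝ, ℝ).prod (𝓡 3)) ((𝓡 3).prod 𝓘(ℝ, Literature.Geometry.Lorentzian.E3 →L[ℝ] Literature.Geometry.Lorentzian.E3 →L[ℝ] ℝ)) ((⊤ : ℕ∞) : WithTop ℕ∞) (fun p : ℝ × X ↦ Bundle.TotalSpace.mk' (F := Literature.Geometry.Lorentzian.E3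 →L[ℝ] Literature.Geometry.Lorentzian.E3 →L[ℝ] ℝ) (E := fun x : X ↦ TangentSpace (𝓡 3) x →L[ℝ] TangentSpace (𝓡 3) x →L[ℝ] ℝ) p.2 ((G p.1).h.inner p.2)) {p : ℝ × X | Rstar < p.1} ∧ ContMDiffOn (𝓘(ℝ, ℝ).prod (𝓡 3)) ((𝓡 3).prod 𝓘(ℝ, Literature.Geometry.Lorentzian.E3 →L[ℝ] Literature.Geometry.Lorentzian.E3 →L[ℝ] ℝ)) ((⊤ : ℕ∞) : WithTop ℕ∞) (fun p : ℝ × X ↦ Bundle.TotalSpace.mk' (F := Literature.Geometry.Lorentzian.E3 →L[ℝ] Literature.Geometry.Lorentzian.E3 →L[ℝ] ℝ) (E := fun x : X ↦ TangentSpace (𝓡 3) x →L[ℝ] TangentSpace (𝓡 3) x →L[ℝ] ℝ) p.2 ((G p.1).k p.2)) {p : ℝ × X | Rstar < p.1}) ∧ ∀ R : ℝ, Rstar < R → G R ∈ Literature.Geometry.Lorentzian.admissibleVacuumData X ∧ (∀ x ∉ e.far R, (G R).h.inner x = d.h.inner x ∧ (G R).k x = d.k x) ∧ η * R ≤ m R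 ∧ ∀ x : Literature.Geometry.Lorentzian.E3, 32 * R < ‖x‖ → Literature.Geometry.Lorentzian.AFEnd.hCoeff e (G R) x = (1 + m R / (2 * ‖x‖)) ^ 4 • (innerSL ℝ : Literature.Geometry.Lorentzian.E3 →L[ℝ] Literature.Geometry.Lorentzian.E3 →L[ℝ] ℝ) ∧ Literature.Geometry.Lorentzian.AFEnd.kCoeff e (G R) x = 0) →
    (∀ μ₀ : ℝ, 0 < μ₀ → ∃ μ : ℝ, 0 < μ ∧ μ ≤ μ₀ ∧ ∃ (M R₁ : ℝ) (C : Literature.Geometry.Lorentzian.InitialDataSet (𝓡 3) Literature.Geometry.Lorentzian.E3), 2 < R₁ ∧ 40 * R₁ < M ∧ (∀ [C.metric.HasLeviCivita], ∀ y ∈ {y : Literature.Geometry.Lorentzian.E3 | 1 < ‖y‖}, C.hamiltonianConstraintFn y = 0 ∧ C.momentumConstraintFn y = 0) ∧ (∀ y : Literature.Geometry.Lorentzian.E3, 1 < ‖y‖ → ‖y‖ < 2 → C.h.inner y = (1 + μ / (2 * ‖y‖)) ^ 4 • (innerSL ℝ : Literature.Geometry.Lorentzian.E3 →L[ℝ]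 Literature.Geometry.Lorentzian.E3 →L[ℝ] ℝ) ∧ C.k y = 0) ∧ ∀ y : Literature.Geometry.Lorentzian.E3, R₁ < ‖y‖ → C.h.inner y = (1 + M / (2 * ‖y‖)) ^ 4 • (innerSL ℝ : Literature.Geometry.Lorentzian.E3 →L[ℝ] Literature.Geometry.Lorentzian.E3 →L[ℝ] ℝ) ∧ C.k y = 0) →
    (∀ (X : Type) [TopologicalSpace X] [ChartedSpace Literature.Geometry.Lorentzian.E3 X] [IsManifold (𝓡 3) ((⊤ : ℕ∞) : WithTop ℕ∞) X] [T2Space X] [SecondCountableTopology X] [ConnectedSpace X], ∀ D ∈ Literature.Geometry.Lorentzian.admissibleVacuumData X, (∃ (M' : ℝ) (hM' : 0 < M') (Φ : Literature.Geometry.Lorentzian.Schwarzschild.isotropicExterior M' → X) (hΦ : ContMDiff (𝓡 3) (𝓡 3) (((⊤ : ℕ∞) : WithTop ℕ∞) + 1) Φ) (hΦ' : ∀ u, Function.Injective (mfderiv (𝓡 3) (𝓡 3) Φ u)), Topology.IsOpenEmbedding Φ ∧ (∀ R' : ℝ, M' / 2 ≤ R' → IsCompact (Φ '' {y : Literature.Geometry.Lorentzian.Schwarzschild.isotropicExterior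 M' | R' < ‖(y : Literature.Geometry.Lorentzian.E3)‖})ᶜ) ∧ D.comap Φ hΦ hΦ' = Literature.Geometry.Lorentzian.Schwarzschild.timeSymmetricExteriorData M' hM'.le) → (∃ 𝒟 : Literature.Geometry.Lorentzian.VacuumCauchyDevelopment D, 𝒟.IsMaximal) ∧ ∀ 𝒟 : Literature.Geometry.Lorentzian.VacuumCauchyDevelopment D, 𝒟.IsMaximal → Summit.FinalStateConjecture.HasCompleteNullInfinity 𝒟.toCauchyDevelopment ∧ ∃ (O : Set 𝒟.carrier) (dec : Literature.Geometry.Lorentzian.FinalStateDecomposition 𝒟.toSpacetime O 2), (∀ i, Literature.Geometry.Lorentzian.Kerr.IsSubextremal (dec.mass i) (dec.spin i)) ∧ O = Summit.FinalStateConjecture.exteriorOf 𝒟.toCauchyDevelopment dec.charted ∧ Summit.FinalStateConjecture.HasExhaustiveCharts dec) →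
    (∀ (X : Type) [TopologicalSpace X] [ChartedSpace Literature.Geometry.Lorentzian.E3 X] [IsManifold (𝓡 3) ((⊤ : ℕ∞) : WithTop ℕ∞) X] [T2Space X] [SecondCountableTopology X] [ConnectedSpace X], ∀ d ∈ Literature.Geometry.Lorentzian.admissibleVacuumData X, ∃ F : EuclideanSpace ℝ (Fin 1) → Literature.Geometry.Lorentzian.InitialDataSet (𝓡 3) X, Literature.Geometry.Lorentzian.InitialDataSet.IsSmoothDataFamily 1 F ∧ F 0 = d ∧ Function.Injective F ∧ (∀ c, F c ∈ Literature.Geometry.Lorentzian.admissibleVacuumData X) ∧ ∀ c ≠ 0, (∃ 𝒟 : Literature.Geometry.Lorentzian.VacuumCauchyDevelopment (F c), 𝒟.IsMaximal) ∧ ∀ 𝒟 : Literature.Geometry.Lorentzian.VacuumCauchyDevelopment (F c), 𝒟.IsMaximal → Summit.FinalStateConjecture.HasCompleteNullInfinity 𝒟.toCauchyDevelopment ∧ ∃ (O : Set 𝒟.carrier) (dec : Literature.Geometry.Lorentzian.FinalStateDecomposition 𝒟.toSpacetime O 2), (∀ i, Literature.Geometry.Lorentzian.Kerr.IsSubextremal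 (dec.mass i) (dec.spin i)) ∧ O = Summit.FinalStateConjecture.exteriorOf 𝒟.toCauchyDevelopment dec.charted ∧ Summit.FinalStateConjecture.HasExhaustiveCharts dec) := by
  intro hA hU hS X _ _ _ _ _ _ d hd
  obtain ⟨F, hF, h0, hinj, hadm, hsh⟩ :=
    sheetBurial_of hA (socketBag_of_socketBagDeep hU) stub_socketDilation stub_socketTransportPatch
      stub_sheetBreathing X d hd
  exact ⟨F, hF, h0, hinj, hadm, fun c hc ↦ hS X (F c) (hadm c) (hsh c hc)⟩

/-- **`SheetLineGlue` holds** (item stmt-FinalStateConjecture-15429), stated BY NAME against the route decl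
`Summit.FinalStateConjecture.FinalStateConjecture.Theses.SwallowTheDatum.SheetLineGlue`
(`FarAnnulusGluing → UniversalSocketBag → SheetShieldedSettles → UniversalWitnessFamily`): it is the frame-form
theorem `SwallowTheDatum.sheetLineGlue_frame_proof`, whose type is this decl by `δ`-unfolding. [folklore] -/
theorem SwallowTheDatum.sheetLineGlue_proof :
    Summit.FinalStateConjecture.FinalStateConjecture.Theses.SwallowTheDatum.SheetLineGlue :=
  SwallowTheDatum.sheetLineGlue_frame_proof

end Summit.FinalStateConjecture.FinalStateConjecture.Theorems
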